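import Literature.AlgebraicGeometry.Motives.AbelianVarietyDihedralOrderEightBrauerRelations
import Literature.AlgebraicGeometry.Motives.AbelianVarietySymmetricFourBrauerRelations
import Mathlib.GroupTheory.SpecificGroups.Alternating
import HarnessLib

/-!
# The Brauer relation lattice of the symmetric group `S_4` in full: rank `6`, Bartel–Dokchitser's PRIMITIVE relation
# `Θ = S_4 − S_3 + V' − D_4` (Theorem A, case (3)(a): `S_4 = 𝔽_2² ⋊ S_3`, `Q = S_3` non-cyclic `2`-quasi-elementary, so
# `Prim(S_4) ≅ ℤ/2ℤ`), and the span of the relations induced / lifted from `D_4, A_4, S_3, V_4, V', S_4/V_4 ≅ S_3`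

Layer A1/A2 of the Hodge foundations lane (`lit-hodgefound`, row A1-20⁺ · A2, seat p03 generation 28, row g28-#10) on
the ALGEBRAIC carrier; sequel of `Motives/AbelianVarietyDihedralOrderEightBrauerRelations` (g28-#2, `K(D_4)`, whose
three generators are induced here from the Sylow `2`-subgroup; CONSUMED: `indClassFun_one_apply_eq_div`,
`card_conj_mem_bot`, `indClassFun_top_one`, `mem_ker_linearCombination_indClassFun_one_iff`) and companion of
`Motives/AbelianVarietySymmetricFourBrauerRelations` (g25: the Kani–Rosen isogenies of three `S_4`-relations —
`K + 2S_4 = A_4 + 2D_4` (the lift of `S_3`'s relation), the Klein relations — CITED, not restated; no isogeny is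
restated here).  Bartel–Dokchitser, Theorem A (3)(a): `S_4 ≅ 𝔽_2² ⋊ S_3` with `Q = S_3` quasi-elementary and
non-cyclic, so `Prim(S_4) = ℤ/pℤ = ℤ/2ℤ`, generated by `Θ = G − Q + Σ_U (U ⋊ N_Q U − 𝔽_l^d ⋊ N_Q U)`; for the one
class of lines `U ⊂ 𝔽_2²` the stabiliser `N_Q U ≅ C_2`, `U ⋊ N_Q U = V'` (a non-normal Klein four-group) and
`𝔽_2² ⋊ N_Q U = D_4`: **`Θ = S_4 − S_3 + V' − D_4`**.  Here on Mathlib's `Equiv.Perm (Fin 4)`: the ELEVEN classes of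
subgroups `1, C_2 = ⟨(01)⟩, C_2' = ⟨(01)(23)⟩, C_3, V_4, V' = C((01)), C_4, S_3 = Stab(3), D_4 = C((01)(23)), A_4, S_4`,
all permutation characters explicit (§2), the five class equations solved (§3: free coordinates
`a_1, a_{C_2}, a_{C_2'}, a_{C_3}, a_{V_4}, a_{V'}`; **rank `6`** = the six classes of non-cyclic subgroups), the ℤ-basis
**`Θ, Ind Θ_dih(D_4) = C_2 − C_2' + V_4 − V', Ind Θ_inf(D_4) = C_2' − C_4 − V_4 − V' + 2D_4, Ind_{V'} = 1 − 2C_2 − C_2' + 2V',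
Ind_{S_3} = 1 − 2C_2 − C_3 + 2S_3, Inf_{S_4/V_4} = V_4 − 2D_4 − A_4 + 2S_4`** (§4), and `Prim(S_4) = ℤ/2ℤ` concretely:
on the span `Imprim` of the seven relations induced from `D_4` (three), `V'`, `V_4`, `S_3`, `A_4` (its primitive
`C_2' − C_3 − V_4 + A_4`) or lifted from `S_4/V_4` the coefficient `a_{S_4}` is EVEN, it is `1` on `Θ`, and
`2Θ = Ind Θ_{A_4} + Ind_{V'} − Ind_{S_3} + Inf_{S_4/V_4} ∈ Imprim`; `K(S_4) = ℤΘ + Imprim`.  Everything here is PROVED;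
NO definition, NO named fact (net Literature debt 0).

## Sources, verbatim

A. Bartel, T. Dokchitser, *Brauer relations in finite groups*, J. Eur. Math. Soc. **17** (2015) (arXiv 1103.2047, held
`paper:arxiv-1103.2047`).  Theorem A (3)(a) (p0003): "`S^d` is minimal among the normal subgroups of `G` (for soluble
`G`, this is equivalent to `G ≅ 𝔽_l^d ⋊ Q` with `𝔽_l^d` a faithful irreducible representation of `Q`)"; table, case
3a: `Prim(G) = ℤ` if `Q` cyclic, `ℤ/pℤ` else (`Q` `p`-quasi-elementary); basis "`Θ = G − Q + Σ_U (U ⋊ N_Q U −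
𝔽_l^d ⋊ N_Q U)` if `d > 1`; sum over `U ⊂ 𝔽_l^d` of index `l` up to `G`-conjugacy".  §2 (p0006): Induction,
Inflation, "the rank of `K(G)` is the number of conjugacy classes of non-cyclic subgroups", Examples 2–3 (`S_3`:
`C_l ⋊ H` relations; `C_p × C_p`: `1 − Σ_C C + pG`).  §5 Theorem 4 (3) (the dihedral relation of `D_4`).
H. Lange, R. E. Rodríguez, LNM 2310 (2022), §5.7 (the subgroups `K ⊴ S_4`, `S_3`, `D_4`, `A_4` of `S_4` and the
relations behind Prop. 5.7.4 / Thm. 5.7.6, typed in the companion `Motives/AbelianVarietySymmetricFourBrauerRelations`).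

## Dictionary and what is proved (namespace `Literature.AlgebraicGeometry.Motives.AbelianVariety`)

Representatives (indices `0…10`): `![⊥, zpowers (01), zpowers ((01)(23)), zpowers (012), C({(01)(23), (02)(13)}) = V_4,
C((01)) = V', zpowers (0123), Stab(3) = S_3, C((01)(23)) = D_4, A_4, ⊤]` with `(01) = swap 0 1`,
`(012) = swap 0 1 * swap 1 2`, `(0123) = swap 0 1 * swap 1 2 * swap 2 3`; classes described by `g = 1`,
`g² = 1 ∧ sign g = −1` (transpositions), `g² = 1 ∧ g ≠ 1 ∧ sign g = 1` (double transpositions), `g³ = 1 ∧ g ≠ 1`,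
`g⁴ = 1 ∧ g² ≠ 1`.  `𝒦` any `Submodule ℤ (Fin 11 → ℤ)` with `a ∈ 𝒦 ↔ Σ_i a_i (1_{H_i})^G = 0`.

* §1 `orderOf_symFour`, `mem_kleinPrime_symFour_iff`, `mem_dihedral_symFour_iff` (the memberships in `V_4 = C({(01)(23),(02)(13)})`
  and `S_3 = Stab(3)` are the companion's `mem_centralizer_pair_iff`, `mem_stabilizer_three_iff`, in `A_4` Mathlib's
  `Perm.mem_alternatingGroup` — CONSUMED, not restated), `natCard_subgroups_symFour` (`2,2,3,4,4,4,6,8,12`).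
* §2 `card_conj_mem_*_symFour` (nine marks functions), **`indClassFun_one_apply_symFour`**.
* §3 `symFour_cases` (the `24` elements), `sum_smul_indClassFun_symFour_apply`, **`sum_smul_indClassFun_symFour_eq_zero_iff`**,
  **`relations_mem_symFour`** (`Θ` and the seven induced/lifted relations, as a `Fin 8`-family).
* §4 `mem_brauerRelationLattice_symFour_iff`, **`eq_combination_of_mem_brauerRelationLattice_symFour`**,
  **`brauerRelationLattice_symFour_eq_span`**, `linearIndependent_basis_symFour`,
  `ker_linearCombination_indClassFun_one_symFour_eq_span`, **`finrank_ker_linearCombination_indClassFun_one_symFour`** (`= 6`),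
  **`thetaPrim_not_mem_span_imprimitive_symFour`**, **`two_smul_thetaPrim_eq_symFour`**,
  `two_smul_thetaPrim_mem_span_imprimitive_symFour`, **`brauerRelationLattice_symFour_eq_span_thetaPrim_sup_imprimitive`**.

Honest scope (stated, not hidden): "Imprim" is the explicit span of the seven listed relations of proper subquotients
(complete by the tree's `K(D_4)` (g28-#2), `K(A_4)` (g28-#9), `K(S_3)` (g27-#4), `K(C_2 × C_2)`, `K(cyclic) = 0` and
`S_4/V_4 ≅ S_3` — bookkeeping argued in words, no Lean `Prim` functor).

## References

* [BartelDokchitser2015] A. Bartel, T. Dokchitser, *Brauer relations in finite groups*, JEMS 17 (2015), §1.1 Theorem A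
  (3)(a) and its table, §2, §5 Theorem 4.
* [LangeRodriguez2022] H. Lange, R. E. Rodríguez, *Decomposition of Jacobians by Prym varieties*, LNM 2310, §5.7.
-/

noncomputable section

universe u

open CategoryTheory CategoryTheory.Limits
open Literature.RepresentationTheory.FiniteGroups
open Equiv Equiv.Perm

namespace Literature.AlgebraicGeometry.Motives

namespace AbelianVariety

/-! ## §1 `S_4 = Perm (Fin 4)`: decidable membership in `V_4, V', S_3, D_4, A_4`; orders -/

section SymFourGroup

/-- `|S_4| = 24`. [cite: BartelDokchitser2015, §1.1 Theorem A (3)(a)] -/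
private theorem card_symFour : Fintype.card (Perm (Fin 4)) = 24 := by
  decide

/-- `x ∈ ⟨g⟩ ↔ x ∈ {g^k : k < orderOf g}`. [folklore] -/
private theorem mem_zpowers_symFour_iff (g : Perm (Fin 4)) {n : ℕ} (hn : orderOf g = n) (x : Perm (Fin 4)) :
    x ∈ Subgroup.zpowers g ↔ x ∈ (Finset.range n).image (g ^ ·) := by
  rw [mem_zpowers_iff_mem_range_orderOf, hn]

/-- The orders `2, 2, 3, 4` of `(01), (01)(23), (012), (0123)`. [cite: BartelDokchitser2015, §2 ("cyclic subgroups")] -/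
theorem orderOf_symFour :
    orderOf (swap (0 : Fin 4) 1) = 2 ∧ orderOf (swap (0 : Fin 4) 1 * swap 2 3) = 2 ∧ orderOf (swap (0 : Fin 4) 1 * swap 1 2) = 3 ∧ orderOf (swap (0 : Fin 4) 1 * swap 1 2 * swap 2 3) = 4 := by
  refine ⟨?_, ?_, ?_, ?_⟩
  · rw [orderOf_eq_prime_iff (p := 2)]; decide
  · rw [orderOf_eq_prime_iff (p := 2)]; decide
  · haveI : Fact (Nat.Prime 3) := ⟨Nat.prime_three⟩
    rw [orderOf_eq_prime_iff (p := 3)]; decide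
  · rw [orderOf_eq_iff (by norm_num)]; decide

/-- **`x ∈ V' = C_{S_4}((01)) = {1, (01), (23), (01)(23)} ↔ (01) x = x (01)`.** [cite: BartelDokchitser2015, §1.1 Theorem A (3)(a) ("U ⋊ N_Q U")] -/
theorem mem_kleinPrime_symFour_iff (x : Perm (Fin 4)) :
    x ∈ Subgroup.centralizer ({swap (0 : Fin 4) 1} : Set (Perm (Fin 4))) ↔ swap (0 : Fin 4) 1 * x = x * swap (0 : Fin 4) 1 := by
  rw [Subgroup.mem_centralizer_iff]
  simp only [Set.mem_singleton_iff, forall_eq]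

/-- **`x ∈ D_4 = C_{S_4}((01)(23)) ↔ (01)(23) x = x (01)(23)`** (a Sylow `2`-subgroup). [cite: BartelDokchitser2015, §1.1 Theorem A (3)(a) ("𝔽_l^d ⋊ N_Q U")] -/
theorem mem_dihedral_symFour_iff (x : Perm (Fin 4)) :
    x ∈ Subgroup.centralizer ({swap (0 : Fin 4) 1 * swap 2 3} : Set (Perm (Fin 4))) ↔ swap (0 : Fin 4) 1 * swap 2 3 * x = x * (swap (0 : Fin 4) 1 * swap 2 3) := by
  rw [Subgroup.mem_centralizer_iff]
  simp only [Set.mem_singleton_iff, forall_eq]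

end SymFourGroup

/-! ## §2 The marks and the eleven permutation characters, machine-checked -/

section SymFourMarks

/-- `|{x : Q x}|` as a filter cardinality. [folklore] -/
private theorem natCard_subtype_eq_card_filter_s4 (P : Perm (Fin 4) → Prop) [DecidablePred P]
    (Q : Perm (Fin 4) → Prop) (hQP : ∀ x, Q x ↔ P x) :
    Nat.card {x : Perm (Fin 4) // Q x} = (Finset.univ.filter P).card := by
  rw [← Fintype.card_subtype, ← Nat.card_eq_fintype_card]
  exact Nat.card_congr (Equiv.subtypeEquivRight hQP)

/-- **Marks of `C_2 = ⟨(01)⟩`**: `24` at `1`, `4` on transpositions. [cite: BartelDokchitser2015, §2] -/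
theorem card_conj_mem_transposition_symFour (g : Perm (Fin 4)) :
    Nat.card {x : Perm (Fin 4) // x⁻¹ * g * x ∈ Subgroup.zpowers (swap (0 : Fin 4) 1)} =
      if g = 1 then 24 else if g ^ 2 = 1 ∧ Perm.sign g = -1 then 4 else 0 := by
  classical
  rw [natCard_subtype_eq_card_filter_s4 _ _ fun x ↦ mem_zpowers_symFour_iff _ orderOf_symFour.1 _]
  revert g
  decide

/-- **Marks of `C_2' = ⟨(01)(23)⟩`**: `24` at `1`, `8` on double transpositions. [cite: BartelDokchitser2015, §2] -/
theorem card_conj_mem_doubleTransposition_symFour (g : Perm (Fin 4)) :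
    Nat.card {x : Perm (Fin 4) // x⁻¹ * g * x ∈ Subgroup.zpowers (swap (0 : Fin 4) 1 * swap 2 3)} =
      if g = 1 then 24 else if g ^ 2 = 1 ∧ g ≠ 1 ∧ Perm.sign g = 1 then 8 else 0 := by
  classical
  rw [natCard_subtype_eq_card_filter_s4 _ _ fun x ↦ mem_zpowers_symFour_iff _ orderOf_symFour.2.1 _]
  revert g
  decide

/-- **Marks of `C_3 = ⟨(012)⟩`**: `24` at `1`, `6` on `3`-cycles (`c ~ c²` in `S_4`). [cite: BartelDokchitser2015, §2] -/
theorem card_conj_mem_threeCycle_symFour (g : Perm (Fin 4)) :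
    Nat.card {x : Perm (Fin 4) // x⁻¹ * g * x ∈ Subgroup.zpowers (swap (0 : Fin 4) 1 * swap 1 2)} =
      if g = 1 then 24 else if g ^ 3 = 1 ∧ g ≠ 1 then 6 else 0 := by
  classical
  rw [natCard_subtype_eq_card_filter_s4 _ _ fun x ↦ mem_zpowers_symFour_iff _ orderOf_symFour.2.2.1 _]
  revert g
  decide +kernel

/-- **Marks of `C_4 = ⟨(0123)⟩`**: `24` at `1`, `8` on double transpositions, `8` on `4`-cycles. [cite: BartelDokchitser2015, §2] -/
theorem card_conj_mem_fourCycle_symFour (g : Perm (Fin 4)) :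
    Nat.card {x : Perm (Fin 4) // x⁻¹ * g * x ∈ Subgroup.zpowers (swap (0 : Fin 4) 1 * swap 1 2 * swap 2 3)} =
      if g = 1 then 24 else if g ^ 2 = 1 ∧ g ≠ 1 ∧ Perm.sign g = 1 then 8 else
        if g ^ 4 = 1 ∧ g ^ 2 ≠ 1 then 8 else 0 := by
  classical
  rw [natCard_subtype_eq_card_filter_s4 _ _ fun x ↦ mem_zpowers_symFour_iff _ orderOf_symFour.2.2.2 _]
  revert g
  decide +kernel

/-- **Marks of `V_4 ⊴ S_4`**: `24·[g ∈ V_4]`. [cite: BartelDokchitser2015, §1.1 Theorem A (3)(a)] -/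
theorem card_conj_mem_kleinNormal_symFour (g : Perm (Fin 4)) :
    Nat.card {x : Perm (Fin 4) // x⁻¹ * g * x ∈ Subgroup.centralizer ({swap (0 : Fin 4) 1 * swap 2 3, swap (0 : Fin 4) 2 * swap 1 3} : Set (Perm (Fin 4)))} =
      if g = 1 then 24 else if g ^ 2 = 1 ∧ g ≠ 1 ∧ Perm.sign g = 1 then 24 else 0 := by
  classical
  rw [natCard_subtype_eq_card_filter_s4 _ _ fun x ↦ mem_centralizer_pair_iff _]
  revert g
  decide +kernel

/-- **Marks of `V' = C((01))`**: `24` at `1`, `8` on transpositions, `8` on double transpositions. [cite: BartelDokchitser2015, §1.1 Theorem A (3)(a) ("U ⋊ N_Q U")] -/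
theorem card_conj_mem_kleinPrime_symFour (g : Perm (Fin 4)) :
    Nat.card {x : Perm (Fin 4) // x⁻¹ * g * x ∈ Subgroup.centralizer ({swap (0 : Fin 4) 1} : Set (Perm (Fin 4)))} =
      if g = 1 then 24 else if g ^ 2 = 1 ∧ Perm.sign g = -1 then 8 else
        if g ^ 2 = 1 ∧ g ≠ 1 ∧ Perm.sign g = 1 then 8 else 0 := by
  classical
  rw [natCard_subtype_eq_card_filter_s4 _ _ fun x ↦ mem_kleinPrime_symFour_iff _]
  revert g
  decide +kernel

/-- **Marks of `S_3 = Stab(3)`**: `24` at `1`, `12` on transpositions, `6` on `3`-cycles. [cite: BartelDokchitser2015, §1.1 Theorem A (3)(a) ("Q")] -/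
theorem card_conj_mem_stabThree_symFour (g : Perm (Fin 4)) :
    Nat.card {x : Perm (Fin 4) // x⁻¹ * g * x ∈ MulAction.stabilizer (Perm (Fin 4)) (3 : Fin 4)} =
      if g = 1 then 24 else if g ^ 2 = 1 ∧ Perm.sign g = -1 then 12 else if g ^ 3 = 1 ∧ g ≠ 1 then 6 else 0 := by
  classical
  rw [natCard_subtype_eq_card_filter_s4 _ _ fun x ↦ mem_stabilizer_three_iff _]
  revert g
  decide +kernel

/-- **Marks of `D_4 = C((01)(23))`**: `24` at `1`, `8` on transpositions, `24` on double transpositions, `8` on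
`4`-cycles. [cite: BartelDokchitser2015, §1.1 Theorem A (3)(a) ("𝔽_l^d ⋊ N_Q U"); §5 Theorem 4 (3)] -/
theorem card_conj_mem_dihedral_symFour (g : Perm (Fin 4)) :
    Nat.card {x : Perm (Fin 4) // x⁻¹ * g * x ∈ Subgroup.centralizer ({swap (0 : Fin 4) 1 * swap 2 3} : Set (Perm (Fin 4)))} =
      if g = 1 then 24 else if g ^ 2 = 1 ∧ Perm.sign g = -1 then 8 else
        if g ^ 2 = 1 ∧ g ≠ 1 ∧ Perm.sign g = 1 then 24 else if g ^ 4 = 1 ∧ g ^ 2 ≠ 1 then 8 else 0 := by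
  classical
  rw [natCard_subtype_eq_card_filter_s4 _ _ fun x ↦ mem_dihedral_symFour_iff _]
  revert g
  decide +kernel

/-- **Marks of `A_4 ⊴ S_4`**: `24·[g even]`. [cite: BartelDokchitser2015, §8 Example 4] -/
theorem card_conj_mem_alternating_symFour (g : Perm (Fin 4)) :
    Nat.card {x : Perm (Fin 4) // x⁻¹ * g * x ∈ alternatingGroup (Fin 4)} =
      if Perm.sign g = 1 then 24 else 0 := by
  classical
  rw [natCard_subtype_eq_card_filter_s4 _ _ fun x ↦ (Perm.mem_alternatingGroup (α := Fin 4))]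
  revert g
  decide +kernel

/-- The orders `2, 2, 3, 4, 4, 4, 6, 8, 12` of `C_2, C_2', C_3, V_4, V', C_4, S_3, D_4, A_4`. [cite: BartelDokchitser2015, §2] -/
theorem natCard_subgroups_symFour :
    Nat.card (Subgroup.zpowers (swap (0 : Fin 4) 1)) = 2 ∧ Nat.card (Subgroup.zpowers (swap (0 : Fin 4) 1 * swap 2 3)) = 2 ∧
    Nat.card (Subgroup.zpowers (swap (0 : Fin 4) 1 * swap 1 2)) = 3 ∧ Nat.card ↥(Subgroup.centralizer ({swap (0 : Fin 4) 1 * swap 2 3, swap (0 : Fin 4) 2 * swap 1 3} : Set (Perm (Fin 4)))) = 4 ∧ Nat.card ↥(Subgroup.centralizer ({swap (0 : Fin 4) 1} : Set (Perm (Fin 4)))) = 4 ∧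
    Nat.card (Subgroup.zpowers (swap (0 : Fin 4) 1 * swap 1 2 * swap 2 3)) = 4 ∧ Nat.card ↥(MulAction.stabilizer (Perm (Fin 4)) (3 : Fin 4)) = 6 ∧ Nat.card ↥(Subgroup.centralizer ({swap (0 : Fin 4) 1 * swap 2 3} : Set (Perm (Fin 4)))) = 8 ∧
    Nat.card ↥(alternatingGroup (Fin 4)) = 12 := by
  classical
  obtain ⟨o1, o2, o3, o4⟩ := orderOf_symFour
  refine ⟨?_, ?_, ?_, ?_, ?_, ?_, ?_, ?_, ?_⟩
  · rw [Nat.card_zpowers, o1]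
  · rw [Nat.card_zpowers, o2]
  · rw [Nat.card_zpowers, o3]
  · show Nat.card {x : Perm (Fin 4) // x ∈ Subgroup.centralizer ({swap (0 : Fin 4) 1 * swap 2 3, swap (0 : Fin 4) 2 * swap 1 3} : Set (Perm (Fin 4)))} = 4
    rw [natCard_subtype_eq_card_filter_s4 _ (· ∈ Subgroup.centralizer ({swap (0 : Fin 4) 1 * swap 2 3, swap (0 : Fin 4) 2 * swap 1 3} : Set (Perm (Fin 4)))) mem_centralizer_pair_iff]
    decide
  · show Nat.card {x : Perm (Fin 4) // x ∈ Subgroup.centralizer ({swap (0 : Fin 4) 1} : Set (Perm (Fin 4)))} = 4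
    rw [natCard_subtype_eq_card_filter_s4 _ (· ∈ Subgroup.centralizer ({swap (0 : Fin 4) 1} : Set (Perm (Fin 4)))) mem_kleinPrime_symFour_iff]
    decide
  · rw [Nat.card_zpowers, o4]
  · show Nat.card {x : Perm (Fin 4) // x ∈ MulAction.stabilizer (Perm (Fin 4)) (3 : Fin 4)} = 6
    rw [natCard_subtype_eq_card_filter_s4 _ (· ∈ MulAction.stabilizer (Perm (Fin 4)) (3 : Fin 4)) mem_stabilizer_three_iff]
    decide
  · show Nat.card {x : Perm (Fin 4) // x ∈ Subgroup.centralizer ({swap (0 : Fin 4) 1 * swap 2 3} : Set (Perm (Fin 4)))} = 8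
    rw [natCard_subtype_eq_card_filter_s4 _ (· ∈ Subgroup.centralizer ({swap (0 : Fin 4) 1 * swap 2 3} : Set (Perm (Fin 4)))) mem_dihedral_symFour_iff]
    decide
  · show Nat.card {x : Perm (Fin 4) // x ∈ alternatingGroup (Fin 4)} = 12
    rw [natCard_subtype_eq_card_filter_s4 _ (· ∈ alternatingGroup (Fin 4)) fun x ↦ Perm.mem_alternatingGroup]
    decide

/-- **The eleven permutation characters of `S_4` as explicit functions** (values at `1`, transpositions, double
transpositions, `3`-cycles, `4`-cycles: `24,0,0,0,0`; `12,2,0,0,0`; `12,0,4,0,0`; `8,0,0,2,0`; `6,0,6,0,0`;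
`6,2,2,0,0`; `6,0,2,0,2`; `4,2,0,1,0`; `3,1,3,0,1`; `2,0,2,2,0`; `1,1,1,1,1`). [cite: BartelDokchitser2015, §1.1 ("Θ ∈ K(G) ⟺ Σ_i n_i Ind 1_{H_i} = 0")] -/
theorem indClassFun_one_apply_symFour (g : Perm (Fin 4)) :
    indClassFun (⊥ : Subgroup (Perm (Fin 4))) 1 g = (if g = 1 then (24 : ℂ) else 0) ∧
    indClassFun (Subgroup.zpowers (swap (0 : Fin 4) 1)) 1 g = (if g = 1 then (12 : ℂ) else if (g ^ 2 = 1 ∧ Perm.sign g = -1) then 2 else 0) ∧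
    indClassFun (Subgroup.zpowers (swap (0 : Fin 4) 1 * swap 2 3)) 1 g = (if g = 1 then (12 : ℂ) else if (g ^ 2 = 1 ∧ g ≠ 1 ∧ Perm.sign g = 1) then 4 else 0) ∧
    indClassFun (Subgroup.zpowers (swap (0 : Fin 4) 1 * swap 1 2)) 1 g = (if g = 1 then (8 : ℂ) else if (g ^ 3 = 1 ∧ g ≠ 1) then 2 else 0) ∧
    indClassFun (Subgroup.centralizer ({swap (0 : Fin 4) 1 * swap 2 3, swap (0 : Fin 4) 2 * swap 1 3} : Set (Perm (Fin 4)))) 1 g = (if g = 1 then (6 : ℂ) else if (g ^ 2 = 1 ∧ g ≠ 1 ∧ Perm.sign g = 1) then 6 else 0) ∧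
    indClassFun (Subgroup.centralizer ({swap (0 : Fin 4) 1} : Set (Perm (Fin 4)))) 1 g = (if g = 1 then (6 : ℂ) else if (g ^ 2 = 1 ∧ Perm.sign g = -1) then 2 else if (g ^ 2 = 1 ∧ g ≠ 1 ∧ Perm.sign g = 1) then 2 else 0) ∧
    indClassFun (Subgroup.zpowers (swap (0 : Fin 4) 1 * swap 1 2 * swap 2 3)) 1 g = (if g = 1 then (6 : ℂ) else if (g ^ 2 = 1 ∧ g ≠ 1 ∧ Perm.sign g = 1) then 2 else if (g ^ 4 = 1 ∧ g ^ 2 ≠ 1) then 2 else 0) ∧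
    indClassFun (MulAction.stabilizer (Perm (Fin 4)) (3 : Fin 4)) 1 g = (if g = 1 then (4 : ℂ) else if (g ^ 2 = 1 ∧ Perm.sign g = -1) then 2 else if (g ^ 3 = 1 ∧ g ≠ 1) then 1 else 0) ∧
    indClassFun (Subgroup.centralizer ({swap (0 : Fin 4) 1 * swap 2 3} : Set (Perm (Fin 4)))) 1 g = (if g = 1 then (3 : ℂ) else if (g ^ 2 = 1 ∧ Perm.sign g = -1) then 1 else if (g ^ 2 = 1 ∧ g ≠ 1 ∧ Perm.sign g = 1) then 3 else if (g ^ 4 = 1 ∧ g ^ 2 ≠ 1) then 1 else 0) ∧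
    indClassFun (alternatingGroup (Fin 4)) 1 g = (if Perm.sign g = 1 then (2 : ℂ) else 0) ∧
    indClassFun (⊤ : Subgroup (Perm (Fin 4))) 1 g = 1 := by
  classical
  obtain ⟨c1, c2, c3, c4, c5, c6, c7, c8, c9⟩ := natCard_subgroups_symFour
  refine ⟨?_, ?_, ?_, ?_, ?_, ?_, ?_, ?_, ?_, ?_, ?_⟩
  · rw [indClassFun_one_apply_eq_div, card_conj_mem_bot, Subgroup.card_bot, card_symFour]
    split_ifs <;> norm_num
  · rw [indClassFun_one_apply_eq_div, card_conj_mem_transposition_symFour, c1]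
    split_ifs <;> norm_num
  · rw [indClassFun_one_apply_eq_div, card_conj_mem_doubleTransposition_symFour, c2]
    split_ifs <;> norm_num
  · rw [indClassFun_one_apply_eq_div, card_conj_mem_threeCycle_symFour, c3]
    split_ifs <;> norm_num
  · rw [indClassFun_one_apply_eq_div, card_conj_mem_kleinNormal_symFour, c4]
    split_ifs <;> norm_num
  · rw [indClassFun_one_apply_eq_div, card_conj_mem_kleinPrime_symFour, c5]
    split_ifs <;> norm_num
  · rw [indClassFun_one_apply_eq_div, card_conj_mem_fourCycle_symFour, c6]
    split_ifs <;> norm_num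
  · rw [indClassFun_one_apply_eq_div, card_conj_mem_stabThree_symFour, c7]
    split_ifs <;> norm_num
  · rw [indClassFun_one_apply_eq_div, card_conj_mem_dihedral_symFour, c8]
    split_ifs <;> norm_num
  · rw [indClassFun_one_apply_eq_div, card_conj_mem_alternating_symFour, c9]
    split_ifs <;> norm_num
  · rw [indClassFun_top_one, Pi.one_apply]

end SymFourMarks

/-! ## §3 The five class equations; `Θ` and the seven induced / lifted relations -/

section SymFourRelations

/-- The `24` elements of `S_4`, machine-listed. [folklore] -/
private theorem symFour_cases (g : Perm (Fin 4)) : g = 1 ∨ g = swap (2 : Fin 4) 3 ∨ g = swap (1 : Fin 4) 2 ∨ g = swap (1 : Fin 4) 2 * swap (2 : Fin 4) 3 ∨ g = swap (1 : Fin 4) 3 * swap (3 : Fin 4) 2 ∨ g = swap (1 : Fin 4) 3 ∨ g = swap (0 : Fin 4) 1 ∨ g = swap (0 : Fin 4) 1 * swap (2 : Fin 4) 3 ∨ g = swap (0 : Fin 4) 1 * swap (1 : Fin 4) 2 ∨ g = swap (0 : Fin 4) 1 * swap (1 : Fin 4) 2 * swap (2 : Fin 4) 3 ∨ g = swap (0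 : Fin 4) 1 * swap (1 : Fin 4) 3 * swap (3 : Fin 4) 2 ∨ g = swap (0 : Fin 4) 1 * swap (1 : Fin 4) 3 ∨ g = swap (0 : Fin 4) 2 * swap (2 : Fin 4) 1 ∨ g = swap (0 : Fin 4) 2 * swap (2 : Fin 4) 3 * swap (3 : Fin 4) 1 ∨ g = swap (0 : Fin 4) 2 ∨ g = swap (0 : Fin 4) 2 * swap (2 : Fin 4) 3 ∨ g = swap (0 : Fin 4) 2 * swap (1 : Fin 4) 3 ∨ g = swap (0 : Fin 4) 2 * swap (2 : Fin 4) 1 * swap (1 : Fin 4) 3 ∨ g = swap (0 : Fin 4) 3 * swap (3 : Fin 4) 2 * swap (2 : Fin 4) 1 ∨ g = swap (0 : Fin 4) 3 * swap (3 : Fin 4) 1 ∨ g = swap (0 : Fin 4) 3 * swap (3 : Fin 4) 2 ∨ g = swap (0 : Fin 4) 3 ∨ g = swap (0 : Fin 4) 3 * swap (3 : Fin 4) 1 * swap (1 : Fin 4) 2 ∨ g = swap (0 : Fin 4) 3 * swap (1 : Fin 4) 2 := by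
  revert g
  decide

/-- An eleven-term sum of scalar multiples of functions, evaluated at a point. [folklore] -/
private theorem sum_fin_eleven_smul_apply_s4 (a : Fin 11 → ℤ) (F : Fin 11 → Perm (Fin 4) → ℂ) (g : Perm (Fin 4)) :
    (∑ i : Fin 11, (a i : ℂ) • F i) g = a 0 * F 0 g + a 1 * F 1 g + a 2 * F 2 g + a 3 * F 3 g + a 4 * F 4 g +
      a 5 * F 5 g + a 6 * F 6 g + a 7 * F 7 g + a 8 * F 8 g + a 9 * F 9 g + a 10 * F 10 g := by
  simp [Finset.sum_apply, Fin.sum_univ_succ]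
  ring

/-- The signed-sum test on the eleven representatives, pointwise. [cite: BartelDokchitser2015, §1.1] -/
theorem sum_smul_indClassFun_symFour_apply (a : Fin 11 → ℤ) (g : Perm (Fin 4)) :
    (∑ i : Fin 11, (a i : ℂ) • indClassFun ((![⊥,
        Subgroup.zpowers (swap (0 : Fin 4) 1),
        Subgroup.zpowers (swap (0 : Fin 4) 1 * swap 2 3),
        Subgroup.zpowers (swap (0 : Fin 4) 1 * swap 1 2),
        Subgroup.centralizer ({swap (0 : Fin 4) 1 * swap 2 3, swap (0 : Fin 4) 2 * swap 1 3} : Set (Perm (Fin 4))),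
        Subgroup.centralizer ({swap (0 : Fin 4) 1} : Set (Perm (Fin 4))),
        Subgroup.zpowers (swap (0 : Fin 4) 1 * swap 1 2 * swap 2 3),
        MulAction.stabilizer (Perm (Fin 4)) (3 : Fin 4),
        Subgroup.centralizer ({swap (0 : Fin 4) 1 * swap 2 3} : Set (Perm (Fin 4))),
        alternatingGroup (Fin 4),
        ⊤] :
        Fin 11 → Subgroup (Perm (Fin 4))) i) 1) g =
      a 0 * (if g = 1 then (24 : ℂ) else 0) + a 1 * (if g = 1 then (12 : ℂ) else if (g ^ 2 = 1 ∧ Perm.sign g = -1) then 2 else 0) +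
        a 2 * (if g = 1 then (12 : ℂ) else if (g ^ 2 = 1 ∧ g ≠ 1 ∧ Perm.sign g = 1) then 4 else 0) + a 3 * (if g = 1 then (8 : ℂ) else if (g ^ 3 = 1 ∧ g ≠ 1) then 2 else 0) +
        a 4 * (if g = 1 then (6 : ℂ) else if (g ^ 2 = 1 ∧ g ≠ 1 ∧ Perm.sign g = 1) then 6 else 0) +
        a 5 * (if g = 1 then (6 : ℂ) else if (g ^ 2 = 1 ∧ Perm.sign g = -1) then 2 else if (g ^ 2 = 1 ∧ g ≠ 1 ∧ Perm.sign g = 1) then 2 else 0) +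
        a 6 * (if g = 1 then (6 : ℂ) else if (g ^ 2 = 1 ∧ g ≠ 1 ∧ Perm.sign g = 1) then 2 else if (g ^ 4 = 1 ∧ g ^ 2 ≠ 1) then 2 else 0) +
        a 7 * (if g = 1 then (4 : ℂ) else if (g ^ 2 = 1 ∧ Perm.sign g = -1) then 2 else if (g ^ 3 = 1 ∧ g ≠ 1) then 1 else 0) +
        a 8 * (if g = 1 then (3 : ℂ) else if (g ^ 2 = 1 ∧ Perm.sign g = -1) then 1 else if (g ^ 2 = 1 ∧ g ≠ 1 ∧ Perm.sign g = 1) then 3 else if (g ^ 4 = 1 ∧ g ^ 2 ≠ 1) then 1 else 0) +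
        a 9 * (if Perm.sign g = 1 then (2 : ℂ) else 0) + a 10 := by
  obtain ⟨h0, h1, h2, h3, h4, h5, h6, h7, h8, h9, h10⟩ := indClassFun_one_apply_symFour g
  rw [sum_fin_eleven_smul_apply_s4]
  show (a 0 : ℂ) * indClassFun (⊥ : Subgroup (Perm (Fin 4))) 1 g +
      (a 1 : ℂ) * indClassFun (Subgroup.zpowers (swap (0 : Fin 4) 1)) 1 g +
      (a 2 : ℂ) * indClassFun (Subgroup.zpowers (swap (0 : Fin 4) 1 * swap 2 3)) 1 g +
      (a 3 : ℂ) * indClassFun (Subgroup.zpowers (swap (0 : Fin 4) 1 * swap 1 2)) 1 g +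
      (a 4 : ℂ) * indClassFun (Subgroup.centralizer ({swap (0 : Fin 4) 1 * swap 2 3, swap (0 : Fin 4) 2 * swap 1 3} : Set (Perm (Fin 4)))) 1 g +
      (a 5 : ℂ) * indClassFun (Subgroup.centralizer ({swap (0 : Fin 4) 1} : Set (Perm (Fin 4)))) 1 g +
      (a 6 : ℂ) * indClassFun (Subgroup.zpowers (swap (0 : Fin 4) 1 * swap 1 2 * swap 2 3)) 1 g +
      (a 7 : ℂ) * indClassFun (MulAction.stabilizer (Perm (Fin 4)) (3 : Fin 4)) 1 g +
      (a 8 : ℂ) * indClassFun (Subgroup.centralizer ({swap (0 : Fin 4) 1 * swap 2 3} : Set (Perm (Fin 4)))) 1 g +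
      (a 9 : ℂ) * indClassFun (alternatingGroup (Fin 4)) 1 g +
      (a 10 : ℂ) * indClassFun (⊤ : Subgroup (Perm (Fin 4))) 1 g = _
  rw [h0, h1, h2, h3, h4, h5, h6, h7, h8, h9, h10, mul_one]

/-- **The Brauer relations of `S_4`** on `![1, C_2, C_2', C_3, V_4, V', C_4, S_3, D_4, A_4, S_4]`: `a ∈ K(S_4)` iff
`a_{C_4} = −3a_1 − a_{C_2} − a_{C_2'} − a_{C_3}`, `a_{S_3} = −3a_1 − 2a_{C_2} − a_{C_2'} − a_{C_3} − a_{V'}`,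
`a_{D_4} = a_1 − a_{C_2'} + a_{C_3} − 2a_{V_4} − a_{V'}`, `a_{A_4} = −a_1 − a_{C_2'} − a_{C_3} − a_{V_4}`,
`a_{S_4} = 5a_1 + 2a_{C_2} + 3a_{C_2'} + a_{C_3} + 2a_{V_4} + a_{V'}` (free `a_1, a_{C_2}, a_{C_2'}, a_{C_3}, a_{V_4}, a_{V'}`:
rank `6`) — the five class equations solved. [cite: BartelDokchitser2015, §1.1; §2 ("the rank of K(G) is the number of conjugacy classes of non-cyclic subgroups")] -/
theorem sum_smul_indClassFun_symFour_eq_zero_iff (a : Fin 11 → ℤ) :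
    ∑ i : Fin 11, (a i : ℂ) • indClassFun ((![⊥,
        Subgroup.zpowers (swap (0 : Fin 4) 1),
        Subgroup.zpowers (swap (0 : Fin 4) 1 * swap 2 3),
        Subgroup.zpowers (swap (0 : Fin 4) 1 * swap 1 2),
        Subgroup.centralizer ({swap (0 : Fin 4) 1 * swap 2 3, swap (0 : Fin 4) 2 * swap 1 3} : Set (Perm (Fin 4))),
        Subgroup.centralizer ({swap (0 : Fin 4) 1} : Set (Perm (Fin 4))),
        Subgroup.zpowers (swap (0 : Fin 4) 1 * swap 1 2 * swap 2 3),
        MulAction.stabilizer (Perm (Fin 4)) (3 : Fin 4),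
        Subgroup.centralizer ({swap (0 : Fin 4) 1 * swap 2 3} : Set (Perm (Fin 4))),
        alternatingGroup (Fin 4),
        ⊤] :
        Fin 11 → Subgroup (Perm (Fin 4))) i) 1 = 0 ↔
      a 6 = -3 * a 0 - a 1 - a 2 - a 3 ∧ a 7 = -3 * a 0 - 2 * a 1 - a 2 - a 3 - a 5 ∧
        a 8 = a 0 - a 2 + a 3 - 2 * a 4 - a 5 ∧ a 9 = -a 0 - a 2 - a 3 - a 4 ∧
        a 10 = 5 * a 0 + 2 * a 1 + 3 * a 2 + a 3 + 2 * a 4 + a 5 := by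
  constructor
  · intro h
    have e := fun g ↦ (sum_smul_indClassFun_symFour_apply a g).symm.trans (congr_fun h g)
    have e0 := e 1
    have e1 := e (swap (0 : Fin 4) 1)
    have e2 := e (swap (0 : Fin 4) 1 * swap 2 3)
    have e3 := e (swap (0 : Fin 4) 1 * swap 1 2)
    have e4 := e (swap (0 : Fin 4) 1 * swap 1 2 * swap 2 3)
    simp (config := { decide := true }) only [Pi.zero_apply, if_true, if_false, mul_zero, add_zero] at e0 e1 e2 e3 e4
    have i0 : ((24 * a 0 + 12 * a 1 + 12 * a 2 + 8 * a 3 + 6 * a 4 + 6 * a 5 + 6 * a 6 + 4 * a 7 + 3 * a 8 + 2 * a 9 +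
        a 10 : ℤ) : ℂ) = 0 := by
      push_cast; linear_combination e0
    have i1 : ((2 * a 1 + 2 * a 5 + 2 * a 7 + a 8 + a 10 : ℤ) : ℂ) = 0 := by push_cast; linear_combination e1
    have i2 : ((4 * a 2 + 6 * a 4 + 2 * a 5 + 2 * a 6 + 3 * a 8 + 2 * a 9 + a 10 : ℤ) : ℂ) = 0 := by
      push_cast; linear_combination e2
    have i3 : ((2 * a 3 + a 7 + 2 * a 9 + a 10 : ℤ) : ℂ) = 0 := by push_cast; linear_combination e3
    have i4 : ((2 * a 6 + a 8 + a 10 : ℤ) : ℂ) = 0 := by push_cast; linear_combination e4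
    norm_cast at i0 i1 i2 i3 i4
    omega
  · rintro ⟨h6, h7, h8, h9, h10⟩
    funext g
    rw [sum_smul_indClassFun_symFour_apply, Pi.zero_apply, h6, h7, h8, h9, h10]
    push_cast
    rcases symFour_cases g with rfl | rfl | rfl | rfl | rfl | rfl | rfl | rfl | rfl | rfl | rfl | rfl | rfl | rfl | rfl | rfl | rfl | rfl | rfl | rfl | rfl | rfl | rfl | rfl <;>
    · simp (config := { decide := true }) only [if_true, if_false]
      ring

/-- **`Θ` and the seven imprimitive generators are relations of `S_4`** (as a `Fin 8`-family): `0 ↦ Θ = S_4 − S_3 + V' − D_4`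
(Theorem A (3)(a)); `1 ↦ C_2 − C_2' + V_4 − V'` (induced `Θ_dih` of `D_4`); `2 ↦ C_2' − C_4 − V_4 − V' + 2D_4` (induced
`Θ_inf` of `D_4`); `3 ↦ 1 − 2C_2 − C_2' + 2V'` (induced from `V' ≅ C_2²`); `4 ↦ 1 − 2C_2 − C_3 + 2S_3` (induced from
`S_3`); `5 ↦ V_4 − 2D_4 − A_4 + 2S_4` (lifted from `S_4/V_4 ≅ S_3`); `6 ↦ 1 − 3C_2' + 2V_4` (induced from `V_4`);
`7 ↦ C_2' − C_3 − V_4 + A_4` (induced primitive relation of `A_4`). [cite: BartelDokchitser2015, §1.1 Theorem A (3)(a) (table); §2 (Induction, Inflation, Examples 2–3); §5 Theorem 4 (3)] -/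
theorem relations_mem_symFour (k : Fin 8) :
    ∑ i : Fin 11, (((![![0, 0, 0, 0, 0, 1, 0, -1, -1, 0, 1],
      ![0, 1, -1, 0, 1, -1, 0, 0, 0, 0, 0],
      ![0, 0, 1, 0, -1, -1, -1, 0, 2, 0, 0],
      ![1, -2, -1, 0, 0, 2, 0, 0, 0, 0, 0],
      ![1, -2, 0, -1, 0, 0, 0, 2, 0, 0, 0],
      ![0, 0, 0, 0, 1, 0, 0, 0, -2, -1, 2],
      ![1, 0, -3, 0, 2, 0, 0, 0, 0, 0, 0],
      ![0, 0, 1, -1, -1, 0, 0, 0, 0, 1, 0]] : Fin 8 → Fin 11 → ℤ) k i : ℤ) : ℂ) • indClassFun ((![⊥,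
        Subgroup.zpowers (swap (0 : Fin 4) 1),
        Subgroup.zpowers (swap (0 : Fin 4) 1 * swap 2 3),
        Subgroup.zpowers (swap (0 : Fin 4) 1 * swap 1 2),
        Subgroup.centralizer ({swap (0 : Fin 4) 1 * swap 2 3, swap (0 : Fin 4) 2 * swap 1 3} : Set (Perm (Fin 4))),
        Subgroup.centralizer ({swap (0 : Fin 4) 1} : Set (Perm (Fin 4))),
        Subgroup.zpowers (swap (0 : Fin 4) 1 * swap 1 2 * swap 2 3),
        MulAction.stabilizer (Perm (Fin 4)) (3 : Fin 4),
        Subgroup.centralizer ({swap (0 : Fin 4) 1 * swap 2 3} : Set (Perm (Fin 4))),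
        alternatingGroup (Fin 4),
        ⊤] :
        Fin 11 → Subgroup (Perm (Fin 4))) i) 1 = 0 := by
  refine (sum_smul_indClassFun_symFour_eq_zero_iff _).2 ?_
  fin_cases k <;> simp

/-- **`2Θ = Ind Θ_{A_4} + Ind_{V'} − Ind_{S_3} + Inf_{S_4/V_4}`** — twice the primitive relation is imprimitive.
[cite: BartelDokchitser2015, §1.1 Theorem A (3)(a) ("Prim(G) = … ℤ/pℤ else")] -/
theorem two_smul_thetaPrim_eq_symFour :
    (2 : ℤ) • (![0, 0, 0, 0, 0, 1, 0, -1, -1, 0, 1] : Fin 11 → ℤ) = ![0, 0, 1, -1, -1, 0, 0, 0, 0, 1, 0] + ![1, -2, -1, 0, 0, 2, 0, 0, 0, 0, 0] - ![1, -2, 0, -1, 0, 0, 0, 2, 0, 0, 0] + ![0, 0, 0, 0, 1, 0, 0, 0, -2, -1, 2] := by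
  decide

end SymFourRelations

/-! ## §4 `K(S_4)`: rank `6`, a basis, `Prim(S_4) = ℤ/2ℤ` -/

section SymFourLattice

variable (𝒦 : Submodule ℤ (Fin 11 → ℤ))
  (h𝒦 : ∀ a : Fin 11 → ℤ, a ∈ 𝒦 ↔ ∑ i : Fin 11, (a i : ℂ) • indClassFun ((![⊥,
        Subgroup.zpowers (swap (0 : Fin 4) 1),
        Subgroup.zpowers (swap (0 : Fin 4) 1 * swap 2 3),
        Subgroup.zpowers (swap (0 : Fin 4) 1 * swap 1 2),
        Subgroup.centralizer ({swap (0 : Fin 4) 1 * swap 2 3, swap (0 : Fin 4) 2 * swap 1 3} : Set (Perm (Fin 4))),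
        Subgroup.centralizer ({swap (0 : Fin 4) 1} : Set (Perm (Fin 4))),
        Subgroup.zpowers (swap (0 : Fin 4) 1 * swap 1 2 * swap 2 3),
        MulAction.stabilizer (Perm (Fin 4)) (3 : Fin 4),
        Subgroup.centralizer ({swap (0 : Fin 4) 1 * swap 2 3} : Set (Perm (Fin 4))),
        alternatingGroup (Fin 4),
        ⊤] :
        Fin 11 → Subgroup (Perm (Fin 4))) i) 1 = 0)
include h𝒦

/-- **Membership in `K(S_4)` in coordinates.** [cite: BartelDokchitser2015, §1.1; §2] -/
theorem mem_brauerRelationLattice_symFour_iff (a : Fin 11 → ℤ) :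
    a ∈ 𝒦 ↔ a 6 = -3 * a 0 - a 1 - a 2 - a 3 ∧ a 7 = -3 * a 0 - 2 * a 1 - a 2 - a 3 - a 5 ∧
        a 8 = a 0 - a 2 + a 3 - 2 * a 4 - a 5 ∧ a 9 = -a 0 - a 2 - a 3 - a 4 ∧
        a 10 = 5 * a 0 + 2 * a 1 + 3 * a 2 + a 3 + 2 * a 4 + a 5 :=
  (h𝒦 a).trans (sum_smul_indClassFun_symFour_eq_zero_iff a)

/-- All eight listed relations lie in `K(S_4)`. [cite: BartelDokchitser2015, §1.1 Theorem A (3)(a); §2] -/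
theorem relations_mem_brauerRelationLattice_symFour (k : Fin 8) : (![![0, 0, 0, 0, 0, 1, 0, -1, -1, 0, 1],
      ![0, 1, -1, 0, 1, -1, 0, 0, 0, 0, 0],
      ![0, 0, 1, 0, -1, -1, -1, 0, 2, 0, 0],
      ![1, -2, -1, 0, 0, 2, 0, 0, 0, 0, 0],
      ![1, -2, 0, -1, 0, 0, 0, 2, 0, 0, 0],
      ![0, 0, 0, 0, 1, 0, 0, 0, -2, -1, 2],
      ![1, 0, -3, 0, 2, 0, 0, 0, 0, 0, 0],
      ![0, 0, 1, -1, -1, 0, 0, 0, 0, 1, 0]] : Fin 8 → Fin 11 → ℤ) k ∈ 𝒦 :=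
  (h𝒦 _).2 (relations_mem_symFour k)

/-- **Every relation of `S_4` in the basis `Θ, Ind Θ_dih, Ind Θ_inf, Ind_{V'}, Ind_{S_3}, Inf_{S_4/V_4}`.**
[cite: BartelDokchitser2015, §1.1 Theorem A (3)(a); §2; §5 Theorem 4] -/
theorem eq_combination_of_mem_brauerRelationLattice_symFour {a : Fin 11 → ℤ} (ha : a ∈ 𝒦) :
    a = (3 * a 0 + 2 * a 1 + a 2 - a 3 + a 5) • (![0, 0, 0, 0, 0, 1, 0, -1, -1, 0, 1] : Fin 11 → ℤ) + (2 * a 0 + a 1) • (![0, 1, -1, 0, 1, -1, 0, 0, 0, 0, 0] : Fin 11 → ℤ) +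
      (3 * a 0 + a 1 + a 2 + a 3) • (![0, 0, 1, 0, -1, -1, -1, 0, 2, 0, 0] : Fin 11 → ℤ) + (a 0 + a 3) • (![1, -2, -1, 0, 0, 2, 0, 0, 0, 0, 0] : Fin 11 → ℤ) +
      (-a 3) • (![1, -2, 0, -1, 0, 0, 0, 2, 0, 0, 0] : Fin 11 → ℤ) + (a 0 + a 2 + a 3 + a 4) • (![0, 0, 0, 0, 1, 0, 0, 0, -2, -1, 2] : Fin 11 → ℤ) := by
  obtain ⟨h6, h7, h8, h9, h10⟩ := (mem_brauerRelationLattice_symFour_iff 𝒦 h𝒦 a).1 ha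
  funext i
  fin_cases i <;> simp <;> omega

/-- **`K(S_4) = ℤΘ ⊕ ℤ·Ind Θ_dih ⊕ ℤ·Ind Θ_inf ⊕ ℤ·Ind_{V'} ⊕ ℤ·Ind_{S_3} ⊕ ℤ·Inf_{S_4/V_4}`.**
[cite: BartelDokchitser2015, §1.1 Theorem A (3)(a); §2] -/
theorem brauerRelationLattice_symFour_eq_span :
    𝒦 = Submodule.span ℤ {(![0, 0, 0, 0, 0, 1, 0, -1, -1, 0, 1] : Fin 11 → ℤ), ![0, 1, -1, 0, 1, -1, 0, 0, 0, 0, 0], ![0, 0, 1, 0, -1, -1, -1, 0, 2, 0, 0],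
      ![1, -2, -1, 0, 0, 2, 0, 0, 0, 0, 0], ![1, -2, 0, -1, 0, 0, 0, 2, 0, 0, 0], ![0, 0, 0, 0, 1, 0, 0, 0, -2, -1, 2]} := by
  refine le_antisymm (fun a ha ↦ ?_) (Submodule.span_le.2 ?_)
  · rw [eq_combination_of_mem_brauerRelationLattice_symFour 𝒦 h𝒦 ha]
    refine Submodule.add_mem _ (Submodule.add_mem _ (Submodule.add_mem _ (Submodule.add_mem _ (Submodule.add_mem _
      (Submodule.smul_mem _ _ (Submodule.subset_span (by simp)))
      (Submodule.smul_mem _ _ (Submodule.subset_span (by simp))))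
      (Submodule.smul_mem _ _ (Submodule.subset_span (by simp))))
      (Submodule.smul_mem _ _ (Submodule.subset_span (by simp))))
      (Submodule.smul_mem _ _ (Submodule.subset_span (by simp))))
      (Submodule.smul_mem _ _ (Submodule.subset_span (by simp)))
  · rintro v (rfl | rfl | rfl | rfl | rfl | rfl)
    · exact relations_mem_brauerRelationLattice_symFour 𝒦 h𝒦 0
    · exact relations_mem_brauerRelationLattice_symFour 𝒦 h𝒦 1
    · exact relations_mem_brauerRelationLattice_symFour 𝒦 h𝒦 2
    · exact relations_mem_brauerRelationLattice_symFour 𝒦 h𝒦 3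
    · exact relations_mem_brauerRelationLattice_symFour 𝒦 h𝒦 4
    · exact relations_mem_brauerRelationLattice_symFour 𝒦 h𝒦 5

omit h𝒦 in
/-- The six basis vectors are linearly independent. [cite: BartelDokchitser2015, §2 ("clearly linearly independent")] -/
theorem linearIndependent_basis_symFour :
    LinearIndependent ℤ (![(![0, 0, 0, 0, 0, 1, 0, -1, -1, 0, 1] : Fin 11 → ℤ), ![0, 1, -1, 0, 1, -1, 0, 0, 0, 0, 0], ![0, 0, 1, 0, -1, -1, -1, 0, 2, 0, 0],
      ![1, -2, -1, 0, 0, 2, 0, 0, 0, 0, 0], ![1, -2, 0, -1, 0, 0, 0, 2, 0, 0, 0], ![0, 0, 0, 0, 1, 0, 0, 0, -2, -1, 2]] : Fin 6 → Fin 11 → ℤ) := by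
  rw [Fintype.linearIndependent_iff]
  intro c hc i
  have e0 := congr_fun hc 0
  have e1 := congr_fun hc 1
  have e2 := congr_fun hc 2
  have e3 := congr_fun hc 3
  have e4 := congr_fun hc 4
  have e5 := congr_fun hc 5
  simp [Fin.sum_univ_six] at e0 e1 e2 e3 e4 e5
  fin_cases i <;> simp <;> omega

omit h𝒦 in
/-- The canonical lattice `K(S_4) = ker(a ↦ Σ_i a_i (1_{H_i})^G)` is the span of the six basis vectors.
[cite: BartelDokchitser2015, §1.1 Theorem A (3)(a)] -/
theorem ker_linearCombination_indClassFun_one_symFour_eq_span :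
    LinearMap.ker (Fintype.linearCombination ℤ fun i : Fin 11 ↦ indClassFun ((![⊥,
        Subgroup.zpowers (swap (0 : Fin 4) 1),
        Subgroup.zpowers (swap (0 : Fin 4) 1 * swap 2 3),
        Subgroup.zpowers (swap (0 : Fin 4) 1 * swap 1 2),
        Subgroup.centralizer ({swap (0 : Fin 4) 1 * swap 2 3, swap (0 : Fin 4) 2 * swap 1 3} : Set (Perm (Fin 4))),
        Subgroup.centralizer ({swap (0 : Fin 4) 1} : Set (Perm (Fin 4))),
        Subgroup.zpowers (swap (0 : Fin 4) 1 * swap 1 2 * swap 2 3),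
        MulAction.stabilizer (Perm (Fin 4)) (3 : Fin 4),
        Subgroup.centralizer ({swap (0 : Fin 4) 1 * swap 2 3} : Set (Perm (Fin 4))),
        alternatingGroup (Fin 4),
        ⊤] :
        Fin 11 → Subgroup (Perm (Fin 4))) i) 1) =
      Submodule.span ℤ {(![0, 0, 0, 0, 0, 1, 0, -1, -1, 0, 1] : Fin 11 → ℤ), ![0, 1, -1, 0, 1, -1, 0, 0, 0, 0, 0], ![0, 0, 1, 0, -1, -1, -1, 0, 2, 0, 0],
        ![1, -2, -1, 0, 0, 2, 0, 0, 0, 0, 0], ![1, -2, 0, -1, 0, 0, 0, 2, 0, 0, 0], ![0, 0, 0, 0, 1, 0, 0, 0, -2, -1, 2]} :=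
  brauerRelationLattice_symFour_eq_span _ (mem_ker_linearCombination_indClassFun_one_iff _)

omit h𝒦 in
/-- **`rank K(S_4) = 6`** (on the canonical lattice) — the classes of non-cyclic subgroups `V_4, V', S_3, D_4, A_4, S_4`.
[cite: BartelDokchitser2015, §2] -/
theorem finrank_ker_linearCombination_indClassFun_one_symFour :
    Module.finrank ℤ (LinearMap.ker (Fintype.linearCombination ℤ fun i : Fin 11 ↦ indClassFun ((![⊥,
        Subgroup.zpowers (swap (0 : Fin 4) 1),
        Subgroup.zpowers (swap (0 : Fin 4) 1 * swap 2 3),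
        Subgroup.zpowers (swap (0 : Fin 4) 1 * swap 1 2),
        Subgroup.centralizer ({swap (0 : Fin 4) 1 * swap 2 3, swap (0 : Fin 4) 2 * swap 1 3} : Set (Perm (Fin 4))),
        Subgroup.centralizer ({swap (0 : Fin 4) 1} : Set (Perm (Fin 4))),
        Subgroup.zpowers (swap (0 : Fin 4) 1 * swap 1 2 * swap 2 3),
        MulAction.stabilizer (Perm (Fin 4)) (3 : Fin 4),
        Subgroup.centralizer ({swap (0 : Fin 4) 1 * swap 2 3} : Set (Perm (Fin 4))),
        alternatingGroup (Fin 4),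
        ⊤] :
        Fin 11 → Subgroup (Perm (Fin 4))) i) 1)) = 6 := by
  rw [ker_linearCombination_indClassFun_one_symFour_eq_span]
  have h := linearIndependent_basis_symFour
  rw [show ({(![0, 0, 0, 0, 0, 1, 0, -1, -1, 0, 1] : Fin 11 → ℤ), ![0, 1, -1, 0, 1, -1, 0, 0, 0, 0, 0], ![0, 0, 1, 0, -1, -1, -1, 0, 2, 0, 0], ![1, -2, -1, 0, 0, 2, 0, 0, 0, 0, 0], ![1, -2, 0, -1, 0, 0, 0, 2, 0, 0, 0], ![0, 0, 0, 0, 1, 0, 0, 0, -2, -1, 2]} : Set (Fin 11 → ℤ)) =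
      Set.range (![(![0, 0, 0, 0, 0, 1, 0, -1, -1, 0, 1] : Fin 11 → ℤ), ![0, 1, -1, 0, 1, -1, 0, 0, 0, 0, 0], ![0, 0, 1, 0, -1, -1, -1, 0, 2, 0, 0], ![1, -2, -1, 0, 0, 2, 0, 0, 0, 0, 0], ![1, -2, 0, -1, 0, 0, 0, 2, 0, 0, 0], ![0, 0, 0, 0, 1, 0, 0, 0, -2, -1, 2]] : Fin 6 → Fin 11 → ℤ) by
    ext v
    simp only [Set.mem_insert_iff, Set.mem_singleton_iff, Set.mem_range]
    constructor
    · rintro (rfl | rfl | rfl | rfl | rfl | rfl)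
      exacts [⟨0, rfl⟩, ⟨1, rfl⟩, ⟨2, rfl⟩, ⟨3, rfl⟩, ⟨4, rfl⟩, ⟨5, rfl⟩]
    · rintro ⟨i, rfl⟩
      fin_cases i <;> simp]
  rw [finrank_span_eq_card h, Fintype.card_fin]

omit h𝒦 in
/-- **On the span of the seven imprimitive generators the coefficient of `S_4` is EVEN; on `Θ` it is `1`: `Θ` is
PRIMITIVE.** [cite: BartelDokchitser2015, §1.1 Theorem A (3)(a) ("Prim(G) = … ℤ/pℤ else")] -/
theorem thetaPrim_not_mem_span_imprimitive_symFour :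
    (![0, 0, 0, 0, 0, 1, 0, -1, -1, 0, 1] : Fin 11 → ℤ) ∉ Submodule.span ℤ {(![0, 1, -1, 0, 1, -1, 0, 0, 0, 0, 0] : Fin 11 → ℤ), ![0, 0, 1, 0, -1, -1, -1, 0, 2, 0, 0],
      ![1, -2, -1, 0, 0, 2, 0, 0, 0, 0, 0], ![1, -2, 0, -1, 0, 0, 0, 2, 0, 0, 0],
      ![0, 0, 0, 0, 1, 0, 0, 0, -2, -1, 2], ![1, 0, -3, 0, 2, 0, 0, 0, 0, 0, 0],
      ![0, 0, 1, -1, -1, 0, 0, 0, 0, 1, 0]} := by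
  intro h
  have key : ∀ v ∈ Submodule.span ℤ {(![0, 1, -1, 0, 1, -1, 0, 0, 0, 0, 0] : Fin 11 → ℤ), ![0, 0, 1, 0, -1, -1, -1, 0, 2, 0, 0],
      ![1, -2, -1, 0, 0, 2, 0, 0, 0, 0, 0], ![1, -2, 0, -1, 0, 0, 0, 2, 0, 0, 0],
      ![0, 0, 0, 0, 1, 0, 0, 0, -2, -1, 2], ![1, 0, -3, 0, 2, 0, 0, 0, 0, 0, 0],
      ![0, 0, 1, -1, -1, 0, 0, 0, 0, 1, 0]}, (2 : ℤ) ∣ v 10 := by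
    intro v hv
    refine Submodule.span_induction (p := fun v _ ↦ (2 : ℤ) ∣ v 10) ?_ ?_ ?_ ?_ hv
    · intro w hw
      simp only [Set.mem_insert_iff, Set.mem_singleton_iff] at hw
      rcases hw with rfl | rfl | rfl | rfl | rfl | rfl | rfl <;> decide
    · simp
    · intro x y _ _ hx hy
      simp only [Pi.add_apply]
      exact dvd_add hx hy
    · intro c x _ hx
      simp only [Pi.smul_apply, smul_eq_mul]
      exact Dvd.dvd.mul_left hx c
  have h2 := key _ h
  revert h2
  decide

omit h𝒦 in
/-- **`2Θ` IS in that span.** [cite: BartelDokchitser2015, §1.1 Theorem A (3)(a)] -/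
theorem two_smul_thetaPrim_mem_span_imprimitive_symFour :
    (2 : ℤ) • (![0, 0, 0, 0, 0, 1, 0, -1, -1, 0, 1] : Fin 11 → ℤ) ∈ Submodule.span ℤ {(![0, 1, -1, 0, 1, -1, 0, 0, 0, 0, 0] : Fin 11 → ℤ), ![0, 0, 1, 0, -1, -1, -1, 0, 2, 0, 0],
      ![1, -2, -1, 0, 0, 2, 0, 0, 0, 0, 0], ![1, -2, 0, -1, 0, 0, 0, 2, 0, 0, 0],
      ![0, 0, 0, 0, 1, 0, 0, 0, -2, -1, 2], ![1, 0, -3, 0, 2, 0, 0, 0, 0, 0, 0],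
      ![0, 0, 1, -1, -1, 0, 0, 0, 0, 1, 0]} := by
  rw [two_smul_thetaPrim_eq_symFour]
  refine Submodule.add_mem _ (Submodule.sub_mem _ (Submodule.add_mem _ (Submodule.subset_span (by simp))
    (Submodule.subset_span (by simp))) (Submodule.subset_span (by simp))) (Submodule.subset_span (by simp))

/-- **`K(S_4) = ℤΘ + Imprim`**: with the two previous theorems, `Prim(S_4) = K(S_4)/Imprim ≅ ℤ/2ℤ` generated by `Θ`.
[cite: BartelDokchitser2015, §1.1 Theorem A (3)(a) (table, case 3a: "ℤ/pℤ else")] -/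
theorem brauerRelationLattice_symFour_eq_span_thetaPrim_sup_imprimitive :
    𝒦 = Submodule.span ℤ {(![0, 0, 0, 0, 0, 1, 0, -1, -1, 0, 1] : Fin 11 → ℤ)} ⊔ Submodule.span ℤ {(![0, 1, -1, 0, 1, -1, 0, 0, 0, 0, 0] : Fin 11 → ℤ), ![0, 0, 1, 0, -1, -1, -1, 0, 2, 0, 0],
      ![1, -2, -1, 0, 0, 2, 0, 0, 0, 0, 0], ![1, -2, 0, -1, 0, 0, 0, 2, 0, 0, 0],
      ![0, 0, 0, 0, 1, 0, 0, 0, -2, -1, 2], ![1, 0, -3, 0, 2, 0, 0, 0, 0, 0, 0],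
      ![0, 0, 1, -1, -1, 0, 0, 0, 0, 1, 0]} := by
  refine le_antisymm ?_ (sup_le ((Submodule.span_singleton_le_iff_mem _ _).2
    (relations_mem_brauerRelationLattice_symFour 𝒦 h𝒦 0)) (Submodule.span_le.2 ?_))
  · rw [brauerRelationLattice_symFour_eq_span 𝒦 h𝒦, Submodule.span_le]
    rintro v (rfl | rfl | rfl | rfl | rfl | rfl)
    · exact Submodule.mem_sup_left (Submodule.subset_span rfl)
    · exact Submodule.mem_sup_right (Submodule.subset_span (by simp))
    · exact Submodule.mem_sup_right (Submodule.subset_span (by simp))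
    · exact Submodule.mem_sup_right (Submodule.subset_span (by simp))
    · exact Submodule.mem_sup_right (Submodule.subset_span (by simp))
    · exact Submodule.mem_sup_right (Submodule.subset_span (by simp))
  · rintro v (rfl | rfl | rfl | rfl | rfl | rfl | rfl)
    · exact relations_mem_brauerRelationLattice_symFour 𝒦 h𝒦 1
    · exact relations_mem_brauerRelationLattice_symFour 𝒦 h𝒦 2
    · exact relations_mem_brauerRelationLattice_symFour 𝒦 h𝒦 3
    · exact relations_mem_brauerRelationLattice_symFour 𝒦 h𝒦 4
    · exact relations_mem_brauerRelationLattice_symFour 𝒦 h𝒦 5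
    · exact relations_mem_brauerRelationLattice_symFour 𝒦 h𝒦 6
    · exact relations_mem_brauerRelationLattice_symFour 𝒦 h𝒦 7

end SymFourLattice

end AbelianVariety

end Literature.AlgebraicGeometry.Motives
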